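import Mathlib
import HarnessLib

/-!
# `stub_filterInvariance` — registered stub S2 of line `FilterInvariance`
# (card `band-limited-krylov-dimerisation`), crux `EmbeddedDrudeMourre.GreenKuboContinuation`
# (item stmt-AtomisticToContinuum-12597)

Target `Summits/AtomisticToContinuum/FouriersLaw/Theorems/EmbeddedDrudeMourreGreenKuboContinuationFilterInvariance.lean`
(`ledger propose --supports stmt-AtomisticToContinuum-12597`). The theorem name and signature of
`stub_filterInvariance` are REGISTERED and stay verbatim.

## Content (pure real analysis)

For a finite measure `σ` on `ℝ` and a measurable frequency filter `ψ` with `0 ≤ ψ ≤ 1`, continuous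
at `0` with `ψ 0 = 1`, the Poisson–Abel means `A(ν) = ∫ ν/(ν²+ω²) dσ(ω)` converge to `L` as `ν ↓ 0`
iff the filtered means `B(ν) = ∫ ν/(ν²+ω²) ψ(ω) dσ(ω)` do.

## Proof

`D(ν) = A(ν) - B(ν) = ∫ ν/(ν²+ω²) (1 - ψ(ω)) dσ(ω) ≥ 0`. Given `0 < e ≤ 1/2`, continuity at `0` gives
`δ > 0` with `1 - ψ ≤ e` (hence `ψ ≥ 1/2`) on `(-δ, δ)`; POINTWISE,
`ν/(ν²+ω²) (1 - ψ(ω)) ≤ 2e · ν/(ν²+ω²) ψ(ω) + ν/δ²` (near `0` the first term dominates, away from `0`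
the kernel is `≤ ν/δ²`), so `D(ν) ≤ 2e B(ν) + (ν/δ²) σ(ℝ)`. Under either hypothesis `B` is
eventually bounded (`B ≤ A`), hence `D(ν) → 0`, and `A = B + D`, `B = A - D`.
-/

noncomputable section

namespace Summit.AtomisticToContinuum.FouriersLaw.Theorems.GreenKuboContinuation.BandLimitedKrylov

open Filter Topology MeasureTheory Set

namespace FilterInvariance

/-- The Poisson kernel `ν/(ν²+ω²)` (`ν > 0`) is bounded by `1/ν`. [folklore] -/
theorem poisson_le_one_div {ν : ℝ} (hν : 0 < ν) (ω : ℝ) : ν / (ν ^ 2 + ω ^ 2) ≤ 1 / ν := by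
  rw [div_le_div_iff₀ (by positivity) hν, one_mul]
  nlinarith [sq_nonneg ω]

/-- The filtered Poisson kernel `ν/(ν²+ω²) ψ(ω)` (`ν > 0`, `ψ` measurable, `0 ≤ ψ ≤ 1`) is
integrable against a finite measure. [folklore] -/
theorem integrable_poisson_mul (σ : Measure ℝ) [IsFiniteMeasure σ] {ψ : ℝ → ℝ}
    (hψm : Measurable ψ) (hψ0 : ∀ ω, 0 ≤ ψ ω) (hψ1 : ∀ ω, ψ ω ≤ 1) {ν : ℝ} (hν : 0 < ν) :
    Integrable (fun ω : ℝ => ν / (ν ^ 2 + ω ^ 2) * ψ ω) σ := by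
  refine (integrable_const (1 / ν)).mono' ?_ (ae_of_all _ (fun ω => ?_))
  · have hc : Continuous fun ω : ℝ => ν / (ν ^ 2 + ω ^ 2) :=
      continuous_const.div (by fun_prop) (fun ω => by positivity)
    exact (hc.measurable.mul hψm).aestronglyMeasurable
  · rw [Real.norm_eq_abs, abs_of_nonneg (mul_nonneg (by positivity) (hψ0 ω))]
    calc ν / (ν ^ 2 + ω ^ 2) * ψ ω ≤ ν / (ν ^ 2 + ω ^ 2) :=
          mul_le_of_le_one_right (by positivity) (hψ1 ω)
      _ ≤ 1 / ν := poisson_le_one_div hν ω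

/-- The Poisson kernel `ν/(ν²+ω²)` (`ν > 0`) is integrable against a finite measure. [folklore] -/
theorem integrable_poisson (σ : Measure ℝ) [IsFiniteMeasure σ] {ν : ℝ} (hν : 0 < ν) :
    Integrable (fun ω : ℝ => ν / (ν ^ 2 + ω ^ 2)) σ := by
  have h := integrable_poisson_mul σ (ψ := fun _ => (1 : ℝ)) measurable_const
    (fun _ => zero_le_one) (fun _ => le_rfl) hν
  simpa only [mul_one] using h

/-- The filtered Poisson mean is at most the unfiltered one (`ψ ≤ 1`). [folklore] -/
theorem integral_poisson_mul_le (σ : Measure ℝ) [IsFiniteMeasure σ] {ψ : ℝ → ℝ}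
    (hψm : Measurable ψ) (hψ0 : ∀ ω, 0 ≤ ψ ω) (hψ1 : ∀ ω, ψ ω ≤ 1) {ν : ℝ} (hν : 0 < ν) :
    ∫ ω, ν / (ν ^ 2 + ω ^ 2) * ψ ω ∂σ ≤ ∫ ω, ν / (ν ^ 2 + ω ^ 2) ∂σ :=
  integral_mono (integrable_poisson_mul σ hψm hψ0 hψ1 hν) (integrable_poisson σ hν)
    (fun ω => mul_le_of_le_one_right (by positivity) (hψ1 ω))

/-- **Pointwise key estimate.** If `0 ≤ ψ ≤ 1`, `0 ≤ e ≤ 1/2` and `1 - ψ ≤ e` on `(-δ, δ)`, then for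
`ν > 0` and every `ω`:
`ν/(ν²+ω²) - ν/(ν²+ω²) ψ(ω) ≤ 2e · (ν/(ν²+ω²) ψ(ω)) + ν/δ²`. [folklore] -/
theorem poisson_sub_poisson_mul_le {ψ : ℝ → ℝ} (hψ0 : ∀ ω, 0 ≤ ψ ω) (hψ1 : ∀ ω, ψ ω ≤ 1)
    {e δ ν : ℝ} (he0 : 0 ≤ e) (he : e ≤ 1 / 2) (hδ : 0 < δ) (hν : 0 < ν)
    (hnear : ∀ ω, |ω| < δ → 1 - ψ ω ≤ e) (ω : ℝ) :
    ν / (ν ^ 2 + ω ^ 2) - ν / (ν ^ 2 + ω ^ 2) * ψ ω ≤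
      2 * e * (ν / (ν ^ 2 + ω ^ 2) * ψ ω) + ν / δ ^ 2 := by
  have hP0 : 0 ≤ ν / (ν ^ 2 + ω ^ 2) := by positivity
  have hT0 : 0 ≤ ν / δ ^ 2 := by positivity
  rcases lt_or_ge |ω| δ with hω | hω
  · -- near `0`: `1 - ψ ≤ e ≤ 2 e ψ` since `ψ ≥ 1 - e ≥ 1/2`
    have h1 := hnear ω hω
    have h2 : 1 - ψ ω ≤ 2 * e * ψ ω := by
      nlinarith [mul_nonneg he0 (show 0 ≤ ψ ω - 1 / 2 by linarith)]
    have h3 : ν / (ν ^ 2 + ω ^ 2) * (1 - ψ ω) ≤ ν / (ν ^ 2 + ω ^ 2) * (2 * e * ψ ω) :=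
      mul_le_mul_of_nonneg_left h2 hP0
    nlinarith [h3, hT0]
  · -- away from `0`: the kernel is at most `ν/δ²` and `0 ≤ 1 - ψ ≤ 1`
    have hδω : δ ^ 2 ≤ ω ^ 2 := by
      calc δ ^ 2 ≤ |ω| ^ 2 := pow_le_pow_left₀ hδ.le hω 2
        _ = ω ^ 2 := sq_abs ω
    have hPle : ν / (ν ^ 2 + ω ^ 2) ≤ ν / δ ^ 2 :=
      calc ν / (ν ^ 2 + ω ^ 2) ≤ ν / ω ^ 2 :=
            div_le_div_of_nonneg_left hν.le (lt_of_lt_of_le (by positivity) hδω) (by nlinarith)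
        _ ≤ ν / δ ^ 2 := div_le_div_of_nonneg_left hν.le (by positivity) hδω
    have h4 : 0 ≤ ν / (ν ^ 2 + ω ^ 2) * ψ ω := mul_nonneg hP0 (hψ0 ω)
    have h5 : 0 ≤ 2 * e * (ν / (ν ^ 2 + ω ^ 2) * ψ ω) := by positivity
    have h6 : ψ ω ≤ 1 := hψ1 ω
    nlinarith [h4, h5, hPle, h6]

/-- **Integrated key estimate.** Under the hypotheses of `poisson_sub_poisson_mul_le`, for a finite
measure `σ`: `A(ν) - B(ν) ≤ 2e B(ν) + (ν/δ²) σ(ℝ)`. [folklore] -/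
theorem integral_poisson_sub_le (σ : Measure ℝ) [IsFiniteMeasure σ] {ψ : ℝ → ℝ}
    (hψm : Measurable ψ) (hψ0 : ∀ ω, 0 ≤ ψ ω) (hψ1 : ∀ ω, ψ ω ≤ 1) {e δ ν : ℝ} (he0 : 0 ≤ e)
    (he : e ≤ 1 / 2) (hδ : 0 < δ) (hν : 0 < ν) (hnear : ∀ ω, |ω| < δ → 1 - ψ ω ≤ e) :
    (∫ ω, ν / (ν ^ 2 + ω ^ 2) ∂σ) - ∫ ω, ν / (ν ^ 2 + ω ^ 2) * ψ ω ∂σ ≤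
      2 * e * (∫ ω, ν / (ν ^ 2 + ω ^ 2) * ψ ω ∂σ) + ν / δ ^ 2 * σ.real univ := by
  have hA := integrable_poisson σ hν
  have hB := integrable_poisson_mul σ hψm hψ0 hψ1 hν
  rw [← integral_sub hA hB]
  calc ∫ ω, ν / (ν ^ 2 + ω ^ 2) - ν / (ν ^ 2 + ω ^ 2) * ψ ω ∂σ
      ≤ ∫ ω, (2 * e * (ν / (ν ^ 2 + ω ^ 2) * ψ ω) + ν / δ ^ 2) ∂σ :=
        integral_mono (hA.sub hB) ((hB.const_mul (2 * e)).add (integrable_const _))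
          (fun ω => poisson_sub_poisson_mul_le hψ0 hψ1 he0 he hδ hν hnear ω)
    _ = 2 * e * (∫ ω, ν / (ν ^ 2 + ω ^ 2) * ψ ω ∂σ) + ν / δ ^ 2 * σ.real univ := by
        rw [integral_add (hB.const_mul (2 * e)) (integrable_const _), integral_const_mul,
          integral_const, smul_eq_mul, mul_comm (σ.real univ)]

/-- **The difference of the means tends to `0`** as soon as the filtered means are eventually
bounded: `A(ν) - B(ν) → 0` as `ν ↓ 0`. [folklore] -/
theorem tendsto_integral_poisson_sub (σ : Measure ℝ) [IsFiniteMeasure σ] {ψ : ℝ → ℝ}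
    (hψm : Measurable ψ) (hψ0 : ∀ ω, 0 ≤ ψ ω) (hψ1 : ∀ ω, ψ ω ≤ 1) (hψc : ContinuousAt ψ 0)
    (hψ00 : ψ 0 = 1) {M : ℝ} (hM : 0 < M)
    (hbdd : ∀ᶠ ν in 𝓝[>] (0 : ℝ), ∫ ω, ν / (ν ^ 2 + ω ^ 2) * ψ ω ∂σ ≤ M) :
    Tendsto (fun ν : ℝ => (∫ ω, ν / (ν ^ 2 + ω ^ 2) ∂σ) - ∫ ω, ν / (ν ^ 2 + ω ^ 2) * ψ ω ∂σ)
      (𝓝[>] (0 : ℝ)) (𝓝 0) := by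
  rw [Metric.tendsto_nhds]
  intro ε hε
  -- the tolerance `e` and the window `δ`
  set e : ℝ := min (1 / 2) (ε / (4 * M)) with he_def
  have he0 : 0 < e := lt_min (by norm_num) (by positivity)
  have he2 : e ≤ 1 / 2 := min_le_left _ _
  have heM : 2 * e * M ≤ ε / 2 := by
    have h1 : e ≤ ε / (4 * M) := min_le_right _ _
    calc 2 * e * M ≤ 2 * (ε / (4 * M)) * M := by gcongr
      _ = ε / 2 := by field_simp; ring
  obtain ⟨δ, hδ, hδψ⟩ := Metric.continuousAt_iff.1 hψc e he0
  have hnear : ∀ ω, |ω| < δ → 1 - ψ ω ≤ e := fun ω hω => by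
    have h1 : dist ω 0 < δ := by rwa [Real.dist_eq, sub_zero]
    have h2 := hδψ h1
    rw [hψ00, Real.dist_eq] at h2
    have h3 := (abs_lt.1 h2).1
    linarith
  -- the tail term is small for small `ν`
  have htail : ∀ᶠ ν in 𝓝[>] (0 : ℝ), ν / δ ^ 2 * σ.real univ < ε / 2 := by
    have h : Tendsto (fun ν : ℝ => ν / δ ^ 2 * σ.real univ) (𝓝 0)
        (𝓝 (0 / δ ^ 2 * σ.real univ)) := Continuous.tendsto (by fun_prop) 0
    simp only [zero_div, zero_mul] at h
    exact (h.mono_left nhdsWithin_le_nhds).eventually_lt_const (by positivity)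
  filter_upwards [hbdd, htail, self_mem_nhdsWithin] with ν hB hT hν
  have hD0 : 0 ≤ (∫ ω, ν / (ν ^ 2 + ω ^ 2) ∂σ) - ∫ ω, ν / (ν ^ 2 + ω ^ 2) * ψ ω ∂σ :=
    sub_nonneg.2 (integral_poisson_mul_le σ hψm hψ0 hψ1 hν)
  have hD := integral_poisson_sub_le σ hψm hψ0 hψ1 he0.le he2 hδ hν hnear
  have hBM : 2 * e * (∫ ω, ν / (ν ^ 2 + ω ^ 2) * ψ ω ∂σ) ≤ 2 * e * M :=
    mul_le_mul_of_nonneg_left hB (by positivity)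
  rw [Real.dist_eq, sub_zero, abs_of_nonneg hD0]
  linarith

end FilterInvariance

open FilterInvariance in
/-- **S2 `stub_filterInvariance`** (the card's first lemma). For a finite measure `σ` on `ℝ` and a measurable
filter `ψ` with `0 ≤ ψ ≤ 1`, continuous at `0` with `ψ 0 = 1`, the Poisson–Abel means `∫ ν/(ν²+ω²) dσ(ω)`
converge as `ν ↓ 0` to `L` iff the filtered means `∫ ν/(ν²+ω²) ψ(ω) dσ(ω)` do (split `|ω| < δ` / `≥ δ`: the
far parts are `≤ (ν/δ²) σ(ℝ)`, the near parts differ by at most `sup_{|ω|<δ} |1 - ψ|` times the near Poisson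
mass, which either hypothesis bounds). [folklore] -/
theorem stub_filterInvariance :
    ∀ (σ : Measure ℝ) (ψ : ℝ → ℝ), IsFiniteMeasure σ → Measurable ψ → (∀ ω, 0 ≤ ψ ω) →
      (∀ ω, ψ ω ≤ 1) → ContinuousAt ψ 0 → ψ 0 = 1 → ∀ L : ℝ,
      (Tendsto (fun ν : ℝ => ∫ ω, ν / (ν ^ 2 + ω ^ 2) ∂σ) (𝓝[>] (0 : ℝ)) (𝓝 L) ↔
        Tendsto (fun ν : ℝ => ∫ ω, ν / (ν ^ 2 + ω ^ 2) * ψ ω ∂σ) (𝓝[>] (0 : ℝ)) (𝓝 L)) := by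
  intro σ ψ hσ hψm hψ0 hψ1 hψc hψ00 L
  have hL : L < |L| + 1 := by linarith [le_abs_self L]
  have hM : 0 < |L| + 1 := by positivity
  constructor
  · intro hA
    have hbdd : ∀ᶠ ν in 𝓝[>] (0 : ℝ), ∫ ω, ν / (ν ^ 2 + ω ^ 2) * ψ ω ∂σ ≤ |L| + 1 := by
      filter_upwards [hA.eventually_lt_const hL, self_mem_nhdsWithin] with ν hν hνpos
      exact (integral_poisson_mul_le σ hψm hψ0 hψ1 hνpos).trans hν.le
    have hD := tendsto_integral_poisson_sub σ hψm hψ0 hψ1 hψc hψ00 hM hbdd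
    have h := hA.sub hD
    rw [sub_zero] at h
    refine h.congr' (Eventually.of_forall fun ν => ?_)
    simp only [sub_sub_cancel]
  · intro hB
    have hbdd : ∀ᶠ ν in 𝓝[>] (0 : ℝ), ∫ ω, ν / (ν ^ 2 + ω ^ 2) * ψ ω ∂σ ≤ |L| + 1 :=
      (hB.eventually_lt_const hL).mono fun ν hν => hν.le
    have hD := tendsto_integral_poisson_sub σ hψm hψ0 hψ1 hψc hψ00 hM hbdd
    have h := hB.add hD
    rw [add_zero] at h
    refine h.congr' (Eventually.of_forall fun ν => ?_)
    simp only [add_sub_cancel]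

end Summit.AtomisticToContinuum.FouriersLaw.Theorems.GreenKuboContinuation.BandLimitedKrylov

end
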